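import Literature.AlgebraicGeometry.Morphisms.CechUnitCocycleKodairaSpencer
import Mathlib.Algebra.DualNumber
import HarnessLib

/-!
# The dual numbers as an augmented small extension; the Kodaira–Spencer map is linear; adding derivations to a lift

§6: `A[ε] → A` as an augmented small extension (`dualNumber_isSmallExtension`, `derivLift`, `constLift`), hence
`ksCochain_mem_cechZ1` for EVERY derivation and the `A`-LINEAR Kodaira–Spencer map `ksLinear p ev : DerAt ev →ₗ[A] Ȟ¹(𝒰, 𝒪_X)`
([GortzWedhorn2023] Prop. 27.122: `Lie(Pic) → H¹(𝒪)` via `U[ε]`); summary `diffClass_map_map_eq_ksLinear`.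
§7: `addDer` — adding a `d`-tuple of derivations (in the frame of the kernel) to a lift of a point along a small
extension, `liftDiffCoord_addDer`.
HC_CM is proved only modulo the 7 printed citations until rung 0 closes.

## References
* [GortzWedhorn2023] U. Görtz, T. Wedhorn, *Algebraic Geometry II*, Lemma 26.15, Prop. 27.122 (`Lie(Pic_{X/S}) ≅ R¹f_*𝒪_X` via `U[ε]`).
* [MumfordAV1970] D. Mumford, *Abelian Varieties*, §13 (proof of the Thm. pp. 125–130).
* The Stacks Project, Tag 08SP (deformations of invertible modules), Tag 01ED (Čech cohomology).
-/

noncomputable section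

universe u v

open TensorProduct CategoryTheory AlgebraicGeometry
open Literature.RingTheory.Flat Literature.RingTheory.Flat.IsSmallExtension

namespace Literature.AlgebraicGeometry.Morphisms

namespace CechUnitCocycle

variable {A : Type u} [CommRing A] {X : Scheme.{u}} (f : X ⟶ Spec (.of A)) {ι : Type v} (U : ι → X.Opens)

/-! ## §6 The dual numbers as an augmented small extension; `KS(D)` is a cocycle for every derivation -/

section DualNumbers

open TrivSqZeroExt

variable {f} {U}
variable (A)

/-- The augmentation ideal `ker(A[ε] → A) = A·ε`. [folklore] -/
def dualNumberKer : Ideal (DualNumber A) := RingHom.ker (fstHom A A A).toRingHom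

/-- Membership in the augmentation ideal. [cite: GortzWedhorn2023, Prop. 27.122 (proof)] -/
theorem mem_dualNumberKer_iff (x : DualNumber A) : x ∈ dualNumberKer A ↔ x.fst = 0 := by
  simp [dualNumberKer, RingHom.mem_ker]

/-- The frame `A ≅ ker(A[ε] → A)`, `a ↦ a·ε`. [folklore] -/
def dualNumberFrame : (Fin 1 → A) ≃ₗ[A] ↥(dualNumberKer A) where
  toFun v := ⟨inr (v 0), by rw [mem_dualNumberKer_iff]; simp⟩
  invFun x := fun _ => (x : DualNumber A).snd
  map_add' v w := by apply Subtype.ext; ext <;> simp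
  map_smul' a v := by apply Subtype.ext; ext <;> simp
  left_inv v := by funext ℓ; fin_cases ℓ; simp
  right_inv x := by
    apply Subtype.ext
    obtain ⟨x, hx⟩ := x
    have hx' : x.fst = 0 := (mem_dualNumberKer_iff A x).1 hx
    ext <;> simp [hx']

/-- Unfolding of the frame. [cite: GortzWedhorn2023, Prop. 27.122 (proof)] -/
@[simp] theorem dualNumberFrame_apply (v : Fin 1 → A) : (dualNumberFrame A v : DualNumber A) = inr (v 0) := rfl

/-- Unfolding of the inverse frame. [cite: GortzWedhorn2023, Prop. 27.122 (proof)] -/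
@[simp] theorem dualNumberFrame_symm_apply (x : dualNumberKer A) (ℓ : Fin 1) :
    (dualNumberFrame A).symm x ℓ = (x : DualNumber A).snd := rfl

/-- **`A[ε] → A` is an augmented small extension with kernel framed by `ε`.** [cite: GortzWedhorn2023, Prop. 27.122 (proof)] -/
theorem dualNumber_isSmallExtension :
    IsSmallExtension (fstHom A A A) (fstHom A A A) (dualNumberKer A) (dualNumberFrame A) where
  surjective_π a := ⟨inl a, fst_inl A a⟩
  surjective_ρ a := ⟨inl a, fst_inl A a⟩
  mem_ker_π x := by rw [mem_dualNumberKer_iff]; rfl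
  isNilpotent_ker_ρ := by
    refine ⟨2, ?_⟩
    rw [pow_two, Ideal.zero_eq_bot, ← le_bot_iff]
    refine Ideal.mul_le.2 fun x hx y hy => ?_
    have hx' : x.fst = 0 := by simpa [RingHom.mem_ker] using hx
    have hy' : y.fst = 0 := by simpa [RingHom.mem_ker] using hy
    rw [Ideal.mem_bot]
    ext <;> simp [hx', hy']
  smul_e r v := by
    change inr ((fstHom A A A) r * v 0) = r * inr (v 0)
    ext <;> simp [mul_comm]

/-- `id ∘ fst = fst` (the `hρ` of the dual-number small extension). [cite: GortzWedhorn2023, Prop. 27.122 (proof)] -/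
theorem dualNumber_hρ : (AlgHom.id A A).comp (fstHom A A A) = fstHom A A A := AlgHom.ext fun _ => rfl

variable {A}
variable {B : Type u} [CommRing B] [Algebra A B]

/-- A derivation at `ev` kills `1`. [cite: GortzWedhorn2023, Prop. 27.122 (proof)] -/
theorem DerAt.apply_one {ev : B →ₐ[A] A} {D : B →ₗ[A] A} (hD : D ∈ DerAt ev) : D 1 = 0 := by
  have h : D (1 * 1) = ev 1 * D 1 + ev 1 * D 1 := hD 1 1
  have h1 : ev 1 = 1 := map_one ev
  rw [mul_one, h1, one_mul] at h
  linear_combination -h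

/-- A derivation at `ev` kills the scalars. [cite: GortzWedhorn2023, Prop. 27.122 (proof)] -/
theorem DerAt.apply_algebraMap {ev : B →ₐ[A] A} {D : B →ₗ[A] A} (hD : D ∈ DerAt ev) (a : A) :
    D (algebraMap A B a) = 0 := by
  rw [Algebra.algebraMap_eq_smul_one, map_smul, DerAt.apply_one hD, smul_zero]

/-- **The lift `b ↦ ev(b) + D(b)·ε : B → A[ε]`** of the point `ev` along the tangent vector `D`. [folklore] -/
def derivLift (ev : B →ₐ[A] A) (D : B →ₗ[A] A) (hD : D ∈ DerAt ev) : B →ₐ[A] DualNumber A where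
  toFun b := inl (ev b) + inr (D b)
  map_one' := by ext <;> simp [DerAt.apply_one hD]
  map_mul' b b' := by
    ext
    · simp
    · simp only [map_mul, hD b b', snd_add, snd_inl, snd_inr, zero_add, snd_mul, fst_add, fst_inl, fst_inr,
        add_zero, smul_eq_mul, MulOpposite.smul_eq_mul_unop, MulOpposite.unop_op]
      ring
  map_zero' := by ext <;> simp
  map_add' b b' := by
    ext
    · simp
    · simp only [map_add, snd_add, snd_inl, snd_inr]; abel
  commutes' a := by
    ext
    · simp [algebraMap_eq_inl]
    · simp [algebraMap_eq_inl, DerAt.apply_algebraMap hD]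

/-- Unfolding of `derivLift`. [cite: GortzWedhorn2023, Prop. 27.122 (proof)] -/
@[simp] theorem derivLift_apply (ev : B →ₐ[A] A) (D : B →ₗ[A] A) (hD : D ∈ DerAt ev) (b : B) :
    derivLift ev D hD b = inl (ev b) + inr (D b) := rfl

/-- **The constant lift `b ↦ ev(b) : B → A[ε]`.** [folklore] -/
def constLift (ev : B →ₐ[A] A) : B →ₐ[A] DualNumber A := (Algebra.ofId A (DualNumber A)).comp ev

/-- Unfolding of `constLift`. [cite: GortzWedhorn2023, Prop. 27.122 (proof)] -/
@[simp] theorem constLift_apply (ev : B →ₐ[A] A) (b : B) : constLift ev b = inl (ev b) := by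
  simp [constLift, Algebra.ofId_apply, algebraMap_eq_inl]

/-- Both lifts reduce to `ev`. [cite: GortzWedhorn2023, Prop. 27.122 (proof)] -/
theorem fst_comp_derivLift (ev : B →ₐ[A] A) (D : B →ₗ[A] A) (hD : D ∈ DerAt ev) :
    (fstHom A A A).comp (derivLift ev D hD) = (fstHom A A A).comp (constLift ev) := by
  apply AlgHom.ext; intro b; simp

/-- The reduction of the constant lift is `ev`. [cite: GortzWedhorn2023, Prop. 27.122 (proof)] -/
theorem fst_comp_constLift (ev : B →ₐ[A] A) : (fstHom A A A).comp (constLift ev) = ev := by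
  apply AlgHom.ext; intro b; simp

/-- The coordinate of `derivLift − constLift` is `D`. [cite: GortzWedhorn2023, Prop. 27.122 (proof)] -/
theorem liftDiffCoord_derivLift (ev : B →ₐ[A] A) (D : B →ₗ[A] A) (hD : D ∈ DerAt ev) :
    liftDiffCoord (dualNumber_isSmallExtension A) (constLift ev) (derivLift ev D hD)
      (fst_comp_derivLift ev D hD) 0 = D := by
  apply LinearMap.ext; intro b
  rw [liftDiffCoord_apply, dualNumberFrame_symm_apply]
  simp

variable [∀ V : X.Opens, Module.Flat A (Sections f V)]

/-- **The Kodaira–Spencer cochain of ANY derivation is a Čech `1`-cocycle** (it is the difference cochain of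
the two lifts `constLift ev`, `derivLift ev D` over the dual numbers). [cite: GortzWedhorn2023, Prop. 27.122 (proof)] -/
theorem ksCochain_mem_cechZ1 (p : UCocycle f U B) (ev : B →ₐ[A] A) (D : B →ₗ[A] A) (hD : D ∈ DerAt ev) :
    ksCochain p ev D ∈ cechZ1 f U := by
  have h := ksCochain_liftDiffCoord_mem_cechZ1 (dualNumber_isSmallExtension A) (dualNumber_hρ A) p
    (constLift ev) (derivLift ev D hD) (fst_comp_derivLift ev D hD) 0
  rwa [liftDiffCoord_derivLift, fst_comp_constLift] at h

/-- **The Kodaira–Spencer map `KS : Der_A(B, A_{ev}) → Ȟ¹(𝒰, 𝒪_X)` of the transition data `p`, an `A`-LINEAR map.**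
[cite: GortzWedhorn2023, Prop. 27.122] -/
def ksLinear (p : UCocycle f U B) (ev : B →ₐ[A] A) : DerAt ev →ₗ[A] CechH1 f U where
  toFun D := CechH1.mk f U ⟨ksCochain p ev D, ksCochain_mem_cechZ1 p ev D D.2⟩
  map_add' D D' := by
    rw [← map_add]; congr 1; apply Subtype.ext
    simp [ksCochain_add]
  map_smul' a D := by
    rw [RingHom.id_apply, ← map_smul]; congr 1; apply Subtype.ext
    simp [ksCochain_smul]

/-- Unfolding of `ksLinear`. [cite: GortzWedhorn2023, Prop. 27.122 (proof)] -/
theorem ksLinear_apply (p : UCocycle f U B) (ev : B →ₐ[A] A) (D : DerAt ev) :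
    ksLinear p ev D = CechH1.mk f U ⟨ksCochain p ev D, ksCochain_mem_cechZ1 p ev D D.2⟩ := rfl

variable {R R₀ : Type u} [CommRing R] [CommRing R₀] [Algebra A R] [Algebra A R₀]
  {π : R →ₐ[A] R₀} {ρ : R →ₐ[A] A} {I : Ideal R} {d : ℕ} {e : (Fin d → A) ≃ₗ[A] I}
  (H : IsSmallExtension π ρ I e) {ρ₀ : R₀ →ₐ[A] A} (hρ : ρ₀.comp π = ρ)

include hρ in
/-- **SUMMARY (3c): along a small extension, the difference class of the transition cocycles of two lifts
`φ', φ''` of the same point is `KS` of the tangent vector `φ'' − φ'` (coordinatewise in the frame of `I`).**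
[cite: GortzWedhorn2023, Prop. 27.122 (proof)] [cite: MumfordAV1970, §13 (proof of the Thm. p. 125)] -/
theorem diffClass_map_map_eq_ksLinear (p : UCocycle f U B) (φ' φ'' : B →ₐ[A] R) (hφ : π.comp φ'' = π.comp φ')
    (ℓ : Fin d) :
    diffClass H hρ (p.map φ') (p.map φ'') (sameRed_map_map p φ' φ'' hφ) ℓ =
      ksLinear p (ρ.comp φ') ⟨liftDiffCoord H φ' φ'' hφ ℓ, liftDiffCoord_mem_derAt H hρ φ' φ'' hφ ℓ⟩ := by
  rw [diffClass_map_map H hρ, ksLinear_apply]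

end DualNumbers

/-! ## §7 Adding a `d`-tuple of derivations to a lift -/

section AddDer

variable {f} {U}
variable {B : Type u} [CommRing B] [Algebra A B]
variable {R R₀ : Type u} [CommRing R] [CommRing R₀] [Algebra A R] [Algebra A R₀]
  {π : R →ₐ[A] R₀} {ρ : R →ₐ[A] A} {I : Ideal R} {d : ℕ} {e : (Fin d → A) ≃ₗ[A] I}
  (H : IsSmallExtension π ρ I e) {ρ₀ : R₀ →ₐ[A] A} (hρ : ρ₀.comp π = ρ)

include H hρ

/-- **The lift `φ' + e(D)`**: adding a `d`-tuple of derivations at `ρ ∘ φ'` to a lift `φ' : B → R`.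
[cite: GortzWedhorn2023, Prop. 27.122 (proof)] -/
def addDer (φ' : B →ₐ[A] R) (D : Fin d → DerAt (ρ.comp φ')) : B →ₐ[A] R where
  toFun b := φ' b + (e (fun ℓ => (D ℓ : B →ₗ[A] A) b) : R)
  map_one' := by
    have : (fun ℓ => (D ℓ : B →ₗ[A] A) 1) = 0 := by funext ℓ; exact DerAt.apply_one (D ℓ).2
    rw [map_one, this, map_zero, Submodule.coe_zero, add_zero]
  map_mul' b b' := by
    have hD : (fun ℓ => (D ℓ : B →ₗ[A] A) (b * b')) =
        (fun ℓ => ρ (φ' b) * (D ℓ : B →ₗ[A] A) b') + fun ℓ => ρ (φ' b') * (D ℓ : B →ₗ[A] A) b := by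
      funext ℓ; simp only [Pi.add_apply]; exact (D ℓ).2 b b'
    rw [map_mul, hD, map_add, Submodule.coe_add, H.smul_e, H.smul_e]
    have hII : (e (fun ℓ => (D ℓ : B →ₗ[A] A) b) : R) * (e (fun ℓ => (D ℓ : B →ₗ[A] A) b') : R) = 0 :=
      mul_e_eq_zero_of_mem H hρ (e _).2 _
    calc φ' b * φ' b' + (φ' b * ↑(e fun ℓ => (D ℓ : B →ₗ[A] A) b') + φ' b' * ↑(e fun ℓ => (D ℓ : B →ₗ[A] A) b))
        = φ' b * φ' b' + φ' b * ↑(e fun ℓ => (D ℓ : B →ₗ[A] A) b') + φ' b' * ↑(e fun ℓ => (D ℓ : B →ₗ[A] A) b) +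
          ↑(e fun ℓ => (D ℓ : B →ₗ[A] A) b) * ↑(e fun ℓ => (D ℓ : B →ₗ[A] A) b') := by rw [hII]; ring
      _ = (φ' b + ↑(e fun ℓ => (D ℓ : B →ₗ[A] A) b)) * (φ' b' + ↑(e fun ℓ => (D ℓ : B →ₗ[A] A) b')) := by ring
  map_zero' := by
    have : (fun ℓ => (D ℓ : B →ₗ[A] A) 0) = 0 := by funext ℓ; simp
    rw [map_zero, this, map_zero, Submodule.coe_zero, add_zero]
  map_add' b b' := by
    have : (fun ℓ => (D ℓ : B →ₗ[A] A) (b + b')) =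
        (fun ℓ => (D ℓ : B →ₗ[A] A) b) + fun ℓ => (D ℓ : B →ₗ[A] A) b' := by funext ℓ; simp
    rw [map_add, this, map_add, Submodule.coe_add]; ring
  commutes' a := by
    have : (fun ℓ => (D ℓ : B →ₗ[A] A) (algebraMap A B a)) = 0 := by
      funext ℓ; exact DerAt.apply_algebraMap (D ℓ).2 a
    rw [AlgHom.commutes, this, map_zero, Submodule.coe_zero, add_zero]

/-- Unfolding of `addDer`. [cite: GortzWedhorn2023, Prop. 27.122 (proof)] -/
@[simp] theorem addDer_apply (φ' : B →ₐ[A] R) (D : Fin d → DerAt (ρ.comp φ')) (b : B) :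
    addDer H hρ φ' D b = φ' b + (e (fun ℓ => (D ℓ : B →ₗ[A] A) b) : R) := rfl

/-- `addDer` is a lift of the same point: `π ∘ (φ' + e(D)) = π ∘ φ'`. [cite: GortzWedhorn2023, Prop. 27.122 (proof)] -/
theorem comp_addDer (φ' : B →ₐ[A] R) (D : Fin d → DerAt (ρ.comp φ')) :
    π.comp (addDer H hρ φ' D) = π.comp φ' := by
  apply AlgHom.ext; intro b
  simp only [AlgHom.comp_apply, addDer_apply, map_add]
  rw [(H.mem_ker_π _).2 (e _).2, add_zero]

/-- The coordinates of `addDer φ' D − φ'` are the `D ℓ`. [cite: GortzWedhorn2023, Prop. 27.122 (proof)] -/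
theorem liftDiffCoord_addDer (φ' : B →ₐ[A] R) (D : Fin d → DerAt (ρ.comp φ')) (ℓ : Fin d) :
    liftDiffCoord H φ' (addDer H hρ φ' D) (comp_addDer H hρ φ' D) ℓ = D ℓ := by
  apply LinearMap.ext; intro b
  rw [liftDiffCoord_apply]
  have : (⟨addDer H hρ φ' D b - φ' b, sub_mem_of_comp_eq H φ' (addDer H hρ φ' D) (comp_addDer H hρ φ' D) b⟩ : I) =
      e (fun ℓ => (D ℓ : B →ₗ[A] A) b) := by
    apply Subtype.ext
    simp only [addDer_apply, add_sub_cancel_left]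
  rw [this, LinearEquiv.symm_apply_apply]

end AddDer

end CechUnitCocycle

end Literature.AlgebraicGeometry.Morphisms

end
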